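import Literature.ModelTheory.ExponentialFields.SemialgebraicSigns
import HarnessLib

/-!
# Tarski's process on sign conditions: eliminating one real variable from sign patterns

Topic `Literature/ModelTheory/ExponentialFields`.  The purely semialgebraic step of the
Denef–van den Dries elimination ("which can then be eliminated by Tarski's process", J. Denef,
L. van den Dries, Ann. of Math. 128 (1988), §4): for finitely many polynomials `F₀` in the variables
`Option Λ` (`none` = the variable `t` to be eliminated, `Λ` = coefficient slots) and a set `Pat₀` of
sign patterns, there are finitely many polynomials `F` in the slots alone and a set `Pat` of sign
patterns with

  `(∃ t, (sign p(c, t))_{p ∈ F₀} ∈ Pat₀) ↔ (sign q(c))_{q ∈ F} ∈ Pat`   for all `c ∈ ℝ^Λ`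

(`exists_finset_signs_iff`).  Proof: the set of `(c, t)` with sign pattern in `Pat₀` is semialgebraic
(`SignDetermined.isSemialgebraic`), its projection is semialgebraic (`tarski_seidenberg_option`),
hence sign-determined by finitely many polynomials (`IsSemialgebraic.exists_finset_signDetermined`),
file `SemialgebraicSigns.lean`.

Everything is proved; no named facts.

## References

* J. Denef, L. van den Dries, *p-adic and real subanalytic sets*, Ann. of Math. 128 (1988), §4.
  [DenefvandenDries1988]
* J. Bochnak, M. Coste, M.-F. Roy, *Real Algebraic Geometry*, Springer (1998), Thm. 2.2.1.
  [BochnakCosteRoy1998]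
-/

noncomputable section

open Set MvPolynomial

namespace Literature.ModelTheory.ExponentialFields

universe u

variable {Λ : Type u} [Finite Λ]

/-- The sign pattern of a finite family of polynomials at a point. [folklore] -/
def signVec {ι : Type*} (F : Finset (MvPolynomial ι ℝ)) (x : ι → ℝ) : F → SignType :=
  fun p => SignType.sign (aeval x (p : MvPolynomial ι ℝ))

/-- Sets cut out by sign patterns are sign-determined. [folklore] -/
theorem signDetermined_preimage_signVec {ι : Type*} (F : Finset (MvPolynomial ι ℝ))
    (Pat₀ : Set (F → SignType)) : SignDetermined F {x : ι → ℝ | signVec F x ∈ Pat₀} := by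
  intro x y hxy
  simp only [mem_setOf_eq]
  have : signVec F x = signVec F y := funext fun p => hxy p p.2
  rw [this]

/-- **Tarski's process on sign conditions.**  For finitely many real polynomials `F₀` in the
variables `Option Λ` and a set of sign patterns `Pat₀` there are finitely many polynomials `F` in the
variables `Λ` and a set of sign patterns `Pat` such that, for every `c ∈ ℝ^Λ`,
`(∃ t, signVec F₀ (c, t) ∈ Pat₀) ↔ signVec F c ∈ Pat`. [cite: DenefvandenDries1988, §4] -/
theorem exists_finset_signs_iff (F₀ : Finset (MvPolynomial (Option Λ) ℝ)) (Pat₀ : Set (F₀ → SignType)) :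
    ∃ (F : Finset (MvPolynomial Λ ℝ)) (Pat : Set (F → SignType)),
      ∀ c : Λ → ℝ, (∃ t : ℝ, signVec F₀ (fun o : Option Λ => Option.elim o t c) ∈ Pat₀) ↔ signVec F c ∈ Pat := by
  classical
  set S : Set (Option Λ → ℝ) := {z | signVec F₀ z ∈ Pat₀} with hS
  have hSsa : IsSemialgebraic ℝ S := (signDetermined_preimage_signVec F₀ Pat₀).isSemialgebraic
  have hT := tarski_seidenberg_option (k := ℝ) hSsa
  obtain ⟨F, hF⟩ := hT.exists_finset_signDetermined
  refine ⟨F, signVec F '' {c : Λ → ℝ | ∃ t : ℝ, (fun o : Option Λ => Option.elim o t c) ∈ S}, fun c => ?_⟩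
  constructor
  · intro hc
    exact ⟨c, hc, rfl⟩
  · rintro ⟨c', hc', hcc'⟩
    refine (hF c c' fun p hp => ?_).mpr hc'
    have := congrFun hcc' ⟨p, hp⟩
    exact this.symm

end Literature.ModelTheory.ExponentialFields
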